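import Summits.QuantumFields.YangMills.Theorems.SwapTwistDeficitSheetTrial
import HarnessLib

/-!
# The sheet trial function: the three integral estimates (norm, diagonal transfer energy, swap cross term) and the POLYNOMIAL GAP
# `q_β(g,g) − q_β(g, g∘S) ≥ β^{−k} · c_β^{|E|}` at every fixed lattice size

Fourth module of the FIXED-LATTICE rungs of the trace-door cruxes K2a `ThermalTraceWindow.SubFemtoFirstLevel` (stmt-QuantumFields-28291) and
`SwapTwistDeficit.TwistDeficit` (stmt-QuantumFields-23317) of seat ym-idea-4.  `g = sheetTrial`, `S = configPerm (swap 0 1)`, `|E| = 3L³`,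
`|P|` = number of plaquettes, `c_β^{|E|} = latCE L β` the free row sum (`≥ λ₀(β,L)`, tree `topValue_le_latCE`):

* §1 `exists_mul_pow_le_exp`: `C·β^k ≤ e^{bβ}` for `β ≥ β₁(C,k,b)` (`b > 0`; Mathlib `tendsto_pow_mul_exp_neg_atTop_nhds_zero`);
* §2 `0 < ⟨g,g⟩ ≤ 1`, `⟨g,g⟩ ≥ ballVol(r)^{|E|}` for `L·r ≤ 1/4` (`g = 1` on the box `A_r(sheetCfg L)`);
* §3 DIAGONAL: `q_β(g,g) ≥ e^{−β·8r²|P|} e^{β(2−2r²)|E|} ballVol(r)^{2|E|}` (`L·r ≤ 1/4`), hence with `r = 1/√β`, `β ≥ max(1, 16L²)`: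
  `q_β(g,g) ≥ e^{−(8|P|+2|E|)} (5⁸(8β+1)¹⁹)^{−2|E|} e^{2β|E|}` (the tree's polynomial Haar volume `ballVol_inv_sqrt_ge`);
* §4 CROSS: `q_β(g, g∘S) ≤ e^{β(2|E| − 1/(2L²))}` (the supports of `g` and `g∘S` are one far link apart, `transferKernel_le_of_supports`);
* §5 ★ `sheetTrial_gap`: `∃ k β₁, ∀ β ≥ β₁, β^{−k} · latCE L β ≤ q_β(g,g) − q_β(g,g∘S)` (`k = 38|E| + 1`): exponential separation beats polynomial
  volume — the one analytic input of both rungs.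

HONEST FRAMING: crude fixed-lattice Laplace bookkeeping (constants astronomically non-optimal, exponent `k` growing like `L³`); BC5 witnesses for
DRAFT lines onto a RECORD rung; no RG content; nothing about infinite volume, the continuum limit or the Clay gap.  No `sorry`, no new axiom,
no new definition.  References: [cite: ReedSimonIV1978, Thm. XIII.1]; [cite: Luscher1983, §2]; [cite: SeilerLNP1982, §3].
-/

set_option autoImplicit false

noncomputable section

open MeasureTheory Filter Topology Real
open scoped Matrix ComplexConjugate BigOperators
open Literature.MathematicalPhysics.QuantumFieldTheory
open Literature.MathematicalPhysics.QuantumLattice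

namespace Summit.QuantumFields.YangMills.Theorems.FemtoTransferGap

namespace FlatSheet

variable {L : ℕ}

/-! ## §1 Exponentials beat polynomials -/

/-- For `b > 0`: `C·β^k ≤ e^{bβ}` for all large `β` (from `x^k e^{−x} → 0`). [folklore] -/
theorem exists_mul_pow_le_exp (C : ℝ) (k : ℕ) {b : ℝ} (hb : 0 < b) :
    ∃ β₁ : ℝ, 1 ≤ β₁ ∧ ∀ β : ℝ, β₁ ≤ β → C * β ^ k ≤ Real.exp (b * β) := by
  have h1 : Tendsto (fun β : ℝ => (b * β) ^ k * Real.exp (-(b * β))) atTop (𝓝 0) :=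
    (tendsto_pow_mul_exp_neg_atTop_nhds_zero k).comp (tendsto_id.const_mul_atTop hb)
  have h2 : Tendsto (fun β : ℝ => C / b ^ k * ((b * β) ^ k * Real.exp (-(b * β)))) atTop (𝓝 0) := by
    simpa using h1.const_mul (C / b ^ k)
  have h3 : ∀ᶠ β : ℝ in atTop, C / b ^ k * ((b * β) ^ k * Real.exp (-(b * β))) < 1 := h2.eventually (gt_mem_nhds one_pos)
  obtain ⟨β₀, hβ₀⟩ := Filter.eventually_atTop.1 h3
  refine ⟨max β₀ 1, le_max_right _ _, fun β hβ => ?_⟩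
  have h := hβ₀ β ((le_max_left _ _).trans hβ)
  have hbk : b ^ k ≠ 0 := pow_ne_zero _ hb.ne'
  have e1 : C / b ^ k * ((b * β) ^ k * Real.exp (-(b * β))) = C * β ^ k * Real.exp (-(b * β)) := by
    rw [mul_pow]; field_simp
  rw [e1] at h
  have hpos := Real.exp_pos (b * β)
  calc C * β ^ k = C * β ^ k * Real.exp (-(b * β)) * Real.exp (b * β) := by
        rw [mul_assoc (C * β ^ k), ← Real.exp_add, neg_add_cancel, Real.exp_zero, mul_one]
    _ ≤ 1 * Real.exp (b * β) := mul_le_mul_of_nonneg_right h.le hpos.le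
    _ = Real.exp (b * β) := one_mul _

/-! ## §2 The `L²` norm of the trial function -/

variable [NeZero L]

/-- `⟨g, g⟩ ≤ 1` (`0 ≤ g ≤ 1`, probability measure). [folklore] -/
theorem l2_sheetTrial_le_one : l2 (sheetTrial (L := L)) sheetTrial ≤ 1 := by
  unfold l2
  have hint := isPhys_sheetTrial (L := L).integrable_mul isPhys_sheetTrial
  calc ∫ U, sheetTrial U * sheetTrial U ∂configMeasure SU2 L ≤ ∫ _U, (1 : ℝ) ∂configMeasure SU2 L :=
        integral_mono hint (integrable_const 1) fun U =>
          mul_le_one₀ (sheetTrial_le_one U) (sheetTrial_nonneg U) (sheetTrial_le_one U)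
    _ = 1 := by rw [integral_const, smul_eq_mul, mul_one, probReal_univ]

/-- `⟨g, g⟩ ≥ ballVol(r)^{|E|}` when `L·r ≤ 1/4` (`g = 1` on the box `A_r(sheetCfg L)`, of Haar measure `ballVol(r)^{|E|}`). [folklore] -/
theorem l2_sheetTrial_ge_box {r : ℝ} (hLr : (L : ℝ) * r ≤ 1 / 4) :
    ballVol r ^ Fintype.card (Edge 3 L) ≤ l2 (sheetTrial (L := L)) sheetTrial := by
  set A : Set (GaugeConfig 3 L SU2) :=
    {U | ∀ e, frobNorm ((U e : Matrix (Fin 2) (Fin 2) ℂ) - (sheetCfg L e : Matrix (Fin 2) (Fin 2) ℂ)) ≤ r} with hA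
  have hAm : MeasurableSet A := measurableSet_box (sheetCfg L) r
  unfold l2
  have hint := isPhys_sheetTrial (L := L).integrable_mul isPhys_sheetTrial
  have hind : ∫ U, A.indicator (fun _ => (1 : ℝ)) U ∂configMeasure SU2 L = ballVol r ^ Fintype.card (Edge 3 L) := by
    rw [integral_indicator_const _ hAm, smul_eq_mul, mul_one, hA, configMeasure_real_box]
  rw [← hind]
  refine integral_mono ((integrable_const (1 : ℝ)).indicator hAm) hint fun U => ?_
  by_cases hU : U ∈ A
  · rw [Set.indicator_of_mem hU, sheetTrial_eq_one_of_near_sheet hLr hU, mul_one]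
  · rw [Set.indicator_of_notMem hU]; exact mul_nonneg (sheetTrial_nonneg U) (sheetTrial_nonneg U)

/-- `0 < ⟨g, g⟩`. [folklore] -/
theorem l2_sheetTrial_pos : 0 < l2 (sheetTrial (L := L)) sheetTrial := by
  have hL : (0 : ℝ) < L := Nat.cast_pos.2 (Nat.pos_of_ne_zero (NeZero.ne L))
  have hr : (L : ℝ) * (1 / (4 * L)) ≤ 1 / 4 := by rw [mul_one_div, div_le_iff₀ (by positivity)]; nlinarith
  exact lt_of_lt_of_le (pow_pos (ballVol_pos (by positivity)) _) (l2_sheetTrial_ge_box hr)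

/-! ## §3 The diagonal transfer energy from below -/

/-- **Box lower bound**: `q_β(g,g) ≥ e^{−β·8r²|P|} · e^{β(2−2r²)|E|} · ballVol(r)^{2|E|}` for `L·r ≤ 1/4`, `β ≥ 0` (restrict the double integral to
`A_r(sheetCfg L)²`, where `g = 1` and the kernel bound `transferKernel_ge_of_near_sheet` holds). [cite: SeilerLNP1982, §3] -/
theorem qform_sheetTrial_ge_box {β : ℝ} (hβ : 0 ≤ β) {r : ℝ} (hLr : (L : ℝ) * r ≤ 1 / 4) :
    Real.exp (-(β * (8 * r ^ 2 * Fintype.card (Plaquette 3 L)))) * Real.exp (β * (2 - 2 * r ^ 2)) ^ Fintype.card (Edge 3 L) *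
        ballVol r ^ (2 * Fintype.card (Edge 3 L)) ≤ qform su2Rep β (sheetTrial (L := L)) sheetTrial := by
  set A : Set (GaugeConfig 3 L SU2) :=
    {U | ∀ e, frobNorm ((U e : Matrix (Fin 2) (Fin 2) ℂ) - (sheetCfg L e : Matrix (Fin 2) (Fin 2) ℂ)) ≤ r} with hA
  have hAm : MeasurableSet A := measurableSet_box (sheetCfg L) r
  set m : ℝ := Real.exp (-(β * (8 * r ^ 2 * Fintype.card (Plaquette 3 L)))) *
    Real.exp (β * (2 - 2 * r ^ 2)) ^ Fintype.card (Edge 3 L) with hm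
  have hprod : qform su2Rep β (sheetTrial (L := L)) sheetTrial =
      ∫ p, sheetTrial p.1 * transferKernel su2Rep β p.1 p.2 * sheetTrial p.2 ∂(configMeasure SU2 L).prod (configMeasure SU2 L) :=
    qform_eq_integral_latProd hβ isPhys_sheetTrial
  have hF : Integrable (fun p : GaugeConfig 3 L SU2 × GaugeConfig 3 L SU2 => sheetTrial p.1 * transferKernel su2Rep β p.1 p.2 * sheetTrial p.2)
      ((configMeasure SU2 L).prod (configMeasure SU2 L)) :=
    integrable_latSandwich (measurable_transferKernel_lat β) (abs_transferKernel_le_lat hβ) measurable_sheetTrial measurable_sheetTrial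
      abs_sheetTrial_le_one abs_sheetTrial_le_one
  have hAA : MeasurableSet (A ×ˢ A) := hAm.prod hAm
  have hind : ∫ p, (A ×ˢ A).indicator (fun _ => m) p ∂(configMeasure SU2 L).prod (configMeasure SU2 L) =
      m * ((configMeasure SU2 L).real A) ^ 2 := by
    rw [integral_indicator_const _ hAA, smul_eq_mul, Measure.real, Measure.prod_prod, ENNReal.toReal_mul]
    rw [← Measure.real]; ring
  have hle : ∫ p, (A ×ˢ A).indicator (fun _ => m) p ∂(configMeasure SU2 L).prod (configMeasure SU2 L) ≤
      ∫ p, sheetTrial p.1 * transferKernel su2Rep β p.1 p.2 * sheetTrial p.2 ∂(configMeasure SU2 L).prod (configMeasure SU2 L) := by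
    refine integral_mono ((integrable_const m).indicator hAA) hF fun p => ?_
    by_cases hp : p ∈ A ×ˢ A
    · rw [Set.indicator_of_mem hp]
      obtain ⟨hU, hV⟩ := Set.mem_prod.1 hp
      rw [sheetTrial_eq_one_of_near_sheet hLr hU, sheetTrial_eq_one_of_near_sheet hLr hV, one_mul, mul_one]
      exact transferKernel_ge_of_near_sheet hβ hU hV
    · rw [Set.indicator_of_notMem hp]
      have := transferKernel_pos su2Rep β p.1 p.2
      have := sheetTrial_nonneg p.1
      have := sheetTrial_nonneg p.2
      positivity
  rw [hind, hA, configMeasure_real_box, ← pow_mul, mul_comm (Fintype.card (Edge 3 L)) 2] at hle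
  rw [hprod]
  exact hle

/-- **Polynomial diagonal bound**: for `β ≥ max(1, 16L²)` (radius `r = 1/√β`, so `L·r ≤ 1/4` and `βr² = 1`),
`q_β(g,g) ≥ e^{−(8|P|+2|E|)} · (5⁸(8β+1)¹⁹)^{−2|E|} · (e^{2β})^{|E|}`. [cite: Luscher1983, §2] -/
theorem qform_sheetTrial_ge_poly {β : ℝ} (hβ1 : 1 ≤ β) (hβL : 16 * (L : ℝ) ^ 2 ≤ β) :
    Real.exp (-(8 * (Fintype.card (Plaquette 3 L) : ℝ) + 2 * Fintype.card (Edge 3 L))) *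
        (((5 : ℝ) ^ 8 * (8 * β + 1) ^ 19)⁻¹) ^ (2 * Fintype.card (Edge 3 L)) * Real.exp (2 * β) ^ Fintype.card (Edge 3 L) ≤
      qform su2Rep β (sheetTrial (L := L)) sheetTrial := by
  have hβ0 : 0 < β := by linarith
  have hsβ : 0 < Real.sqrt β := Real.sqrt_pos.2 hβ0
  have hL : (0 : ℝ) < L := Nat.cast_pos.2 (Nat.pos_of_ne_zero (NeZero.ne L))
  -- `L / √β ≤ 1/4` from `16 L² ≤ β`
  have hLr : (L : ℝ) * (1 / Real.sqrt β) ≤ 1 / 4 := by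
    rw [mul_one_div, div_le_iff₀ hsβ]
    have h4 : 4 * (L : ℝ) ≤ Real.sqrt β := by
      have hsq : (4 * (L : ℝ)) ^ 2 ≤ β := by nlinarith
      have h := Real.sqrt_le_sqrt hsq
      rwa [Real.sqrt_sq (by positivity)] at h
    linarith
  have hbox := qform_sheetTrial_ge_box (L := L) hβ0.le hLr
  have hr2 : β * (1 / Real.sqrt β) ^ 2 = 1 := by
    rw [div_pow, one_pow, Real.sq_sqrt hβ0.le]; field_simp
  -- rewrite the exponentials at `βr² = 1`
  have e1 : Real.exp (-(β * (8 * (1 / Real.sqrt β) ^ 2 * Fintype.card (Plaquette 3 L)))) *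
      Real.exp (β * (2 - 2 * (1 / Real.sqrt β) ^ 2)) ^ Fintype.card (Edge 3 L) =
      Real.exp (-(8 * (Fintype.card (Plaquette 3 L) : ℝ) + 2 * Fintype.card (Edge 3 L))) * Real.exp (2 * β) ^ Fintype.card (Edge 3 L) := by
    have a1 : -(β * (8 * (1 / Real.sqrt β) ^ 2 * Fintype.card (Plaquette 3 L))) = -(8 * (Fintype.card (Plaquette 3 L) : ℝ)) := by
      have : β * (8 * (1 / Real.sqrt β) ^ 2 * Fintype.card (Plaquette 3 L)) = 8 * (β * (1 / Real.sqrt β) ^ 2) * Fintype.card (Plaquette 3 L) := by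
        ring
      rw [this, hr2, mul_one]
    have a2 : β * (2 - 2 * (1 / Real.sqrt β) ^ 2) = 2 * β + -(2 : ℝ) := by
      have : β * (2 - 2 * (1 / Real.sqrt β) ^ 2) = 2 * β - 2 * (β * (1 / Real.sqrt β) ^ 2) := by ring
      rw [this, hr2]; ring
    rw [a1, a2, Real.exp_add, mul_pow, ← Real.exp_nat_mul (-(2 : ℝ)) (Fintype.card (Edge 3 L)),
      show -(8 * (Fintype.card (Plaquette 3 L) : ℝ) + 2 * Fintype.card (Edge 3 L)) =
        -(8 * (Fintype.card (Plaquette 3 L) : ℝ)) + (Fintype.card (Edge 3 L) : ℕ) * (-2 : ℝ) by ring, Real.exp_add]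
    ring
  rw [e1] at hbox
  -- `ballVol (1/√β) ≥ (5⁸(8β+1)¹⁹)⁻¹`
  have hball : (((5 : ℝ) ^ 8 * (8 * β + 1) ^ 19)⁻¹) ^ (2 * Fintype.card (Edge 3 L)) ≤ ballVol (1 / Real.sqrt β) ^ (2 * Fintype.card (Edge 3 L)) :=
    pow_le_pow_left₀ (by positivity) (ballVol_inv_sqrt_ge hβ1) _
  refine le_trans ?_ hbox
  have h0 : 0 ≤ Real.exp (-(8 * (Fintype.card (Plaquette 3 L) : ℝ) + 2 * Fintype.card (Edge 3 L))) * Real.exp (2 * β) ^ Fintype.card (Edge 3 L) := by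
    positivity
  calc Real.exp (-(8 * (Fintype.card (Plaquette 3 L) : ℝ) + 2 * Fintype.card (Edge 3 L))) *
        (((5 : ℝ) ^ 8 * (8 * β + 1) ^ 19)⁻¹) ^ (2 * Fintype.card (Edge 3 L)) * Real.exp (2 * β) ^ Fintype.card (Edge 3 L)
      = (Real.exp (-(8 * (Fintype.card (Plaquette 3 L) : ℝ) + 2 * Fintype.card (Edge 3 L))) * Real.exp (2 * β) ^ Fintype.card (Edge 3 L)) *
          (((5 : ℝ) ^ 8 * (8 * β + 1) ^ 19)⁻¹) ^ (2 * Fintype.card (Edge 3 L)) := by ring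
    _ ≤ (Real.exp (-(8 * (Fintype.card (Plaquette 3 L) : ℝ) + 2 * Fintype.card (Edge 3 L))) * Real.exp (2 * β) ^ Fintype.card (Edge 3 L)) *
          ballVol (1 / Real.sqrt β) ^ (2 * Fintype.card (Edge 3 L)) := mul_le_mul_of_nonneg_left hball h0
    _ = _ := by ring

/-! ## §4 The swap cross term from above -/

/-- **Cross-term bound**: `q_β(g, g∘S) ≤ e^{β(2|E| − 1/(2L²))}` for `β ≥ 0` — wherever the integrand `g(U) K_β(U,V) g(SV)` is non-zero, one axis
link of `U, V` is `1/L`-far, so the kernel is exponentially below `e^{2β|E|}`; and `0 ≤ g ≤ 1`. [cite: SeilerLNP1982, §3] -/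
theorem qform_sheetTrial_cross_le {β : ℝ} (hβ : 0 ≤ β) :
    qform su2Rep β (sheetTrial (L := L)) (fun U => sheetTrial (configPerm (Equiv.swap (0 : Fin 3) 1) U)) ≤
      Real.exp (β * (2 * (Fintype.card (Edge 3 L) : ℝ) - (1 / (L : ℝ)) ^ 2 / 2)) := by
  set B : ℝ := Real.exp (β * (2 * (Fintype.card (Edge 3 L) : ℝ) - (1 / (L : ℝ)) ^ 2 / 2)) with hB
  have hB0 : 0 ≤ B := (Real.exp_pos _).le
  have hgS : Measurable (fun U : GaugeConfig 3 L SU2 => sheetTrial (configPerm (Equiv.swap (0 : Fin 3) 1) U)) :=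
    measurable_sheetTrial.comp (configPerm (Equiv.swap (0 : Fin 3) 1)).measurable
  have hF := integrable_latSandwich (measurable_transferKernel_lat β) (abs_transferKernel_le_lat hβ) measurable_sheetTrial hgS
      abs_sheetTrial_le_one (fun V => abs_sheetTrial_le_one _)
  have hprod : qform su2Rep β (sheetTrial (L := L)) (fun U => sheetTrial (configPerm (Equiv.swap (0 : Fin 3) 1) U)) =
      ∫ p, sheetTrial p.1 * transferKernel su2Rep β p.1 p.2 * sheetTrial (configPerm (Equiv.swap (0 : Fin 3) 1) p.2)
        ∂(configMeasure SU2 L).prod (configMeasure SU2 L) := (integral_prod _ hF).symm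
  rw [hprod]
  have hpt : ∀ p : GaugeConfig 3 L SU2 × GaugeConfig 3 L SU2,
      sheetTrial p.1 * transferKernel su2Rep β p.1 p.2 * sheetTrial (configPerm (Equiv.swap (0 : Fin 3) 1) p.2) ≤ B := by
    intro p
    by_cases h1 : sheetTrial p.1 = 0
    · rw [h1, zero_mul, zero_mul]; exact hB0
    by_cases h2 : sheetTrial (configPerm (Equiv.swap (0 : Fin 3) 1) p.2) = 0
    · rw [h2, mul_zero]; exact hB0
    have hK := transferKernel_le_of_supports hβ h1 h2
    calc sheetTrial p.1 * transferKernel su2Rep β p.1 p.2 * sheetTrial (configPerm (Equiv.swap (0 : Fin 3) 1) p.2)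
        ≤ 1 * B * 1 := mul_le_mul (mul_le_mul (sheetTrial_le_one _) hK (transferKernel_pos _ _ _ _).le zero_le_one)
          (sheetTrial_le_one _) (sheetTrial_nonneg _) (by positivity)
      _ = B := by ring
  calc ∫ p, sheetTrial p.1 * transferKernel su2Rep β p.1 p.2 * sheetTrial (configPerm (Equiv.swap (0 : Fin 3) 1) p.2)
        ∂(configMeasure SU2 L).prod (configMeasure SU2 L)
      ≤ ∫ _p, B ∂(configMeasure SU2 L).prod (configMeasure SU2 L) := integral_mono hF (integrable_const B) hpt
    _ = B := by rw [integral_const, smul_eq_mul, probReal_univ, one_mul]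

/-! ## §5 The polynomial gap -/

variable (L) in
/-- ★ **The polynomial gap of the sheet trial function**: for every lattice size `L ≥ 1` there are `k` (`= 38|E| + 1`) and `β₁` with
`β^{−k} · c_β^{|E|} ≤ q_β(g,g) − q_β(g, g∘S)` for all `β ≥ β₁` — the diagonal energy is within a polynomial factor of the free row sum while the
cross term is exponentially smaller. [cite: ReedSimonIV1978, Thm. XIII.1] [cite: Luscher1983, §2] -/
theorem sheetTrial_gap : ∃ k β₁ : ℝ, 1 ≤ β₁ ∧ ∀ β : ℝ, β₁ ≤ β →
    β ^ (-k) * latCE L β ≤ qform su2Rep β (sheetTrial (L := L)) sheetTrial -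
      qform su2Rep β (sheetTrial (L := L)) (fun U => sheetTrial (configPerm (Equiv.swap (0 : Fin 3) 1) U)) := by
  set E : ℕ := Fintype.card (Edge 3 L) with hE
  set P : ℕ := Fintype.card (Plaquette 3 L) with hP
  have hL : (0 : ℝ) < L := Nat.cast_pos.2 (Nat.pos_of_ne_zero (NeZero.ne L))
  -- the constant `c₁ = ½ e^{−(8P+2E)} (5⁸ 9¹⁹)^{−2E}` of the polynomial floor `c₁ β^{−38E}`
  set c₁ : ℝ := (1 / 2) * Real.exp (-(8 * (P : ℝ) + 2 * E)) * (((5 : ℝ) ^ 8 * 9 ^ 19)⁻¹) ^ (2 * E) with hc₁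
  have hc₁pos : 0 < c₁ := by positivity
  -- (i) exponential separation beats the polynomial floor
  obtain ⟨β₂, hβ₂1, hβ₂⟩ := exists_mul_pow_le_exp (1 / c₁) (38 * E) (b := (1 / (L : ℝ)) ^ 2 / 2) (by positivity)
  refine ⟨((38 * E + 1 : ℕ) : ℝ), max (max (16 * (L : ℝ) ^ 2) β₂) (1 / c₁), le_trans hβ₂1 ((le_max_right _ _).trans (le_max_left _ _)),
    fun β hβ => ?_⟩
  have hβL : 16 * (L : ℝ) ^ 2 ≤ β := (le_max_left _ _).trans ((le_max_left _ _).trans hβ)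
  have hββ₂ : β₂ ≤ β := (le_max_right _ _).trans ((le_max_left _ _).trans hβ)
  have hβc : 1 / c₁ ≤ β := (le_max_right _ _).trans hβ
  have hβ1 : 1 ≤ β := hβ₂1.trans hββ₂
  have hβ0 : 0 < β := by linarith
  -- the floor: `(5⁸(8β+1)¹⁹)⁻¹ ≥ (5⁸ 9¹⁹)⁻¹ β⁻¹⁹` for `β ≥ 1`
  have hV : ((5 : ℝ) ^ 8 * 9 ^ 19)⁻¹ * (β ^ 19)⁻¹ ≤ ((5 : ℝ) ^ 8 * (8 * β + 1) ^ 19)⁻¹ := by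
    rw [← mul_inv]
    refine inv_anti₀ (by positivity) ?_
    rw [mul_assoc, ← mul_pow]
    exact mul_le_mul_of_nonneg_left (pow_le_pow_left₀ (by positivity) (by linarith) 19) (by positivity)
  have hV0 : 0 ≤ ((5 : ℝ) ^ 8 * 9 ^ 19)⁻¹ * (β ^ 19)⁻¹ := by positivity
  have hVpow : (((5 : ℝ) ^ 8 * 9 ^ 19)⁻¹) ^ (2 * E) * (β ^ (38 * E))⁻¹ ≤ (((5 : ℝ) ^ 8 * (8 * β + 1) ^ 19)⁻¹) ^ (2 * E) := by
    have h := pow_le_pow_left₀ hV0 hV (2 * E)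
    rw [mul_pow, ← inv_pow, ← pow_mul, show 19 * (2 * E) = 38 * E by ring, inv_pow β] at h
    exact h
  -- D' := e^{-(8P+2E)} (5⁸(8β+1)¹⁹)^{-2E} e^{2βE} ≤ Q, and 2 c₁ β^{-38E} e^{2βE} ≤ D'
  have hQ := qform_sheetTrial_ge_poly (L := L) hβ1 hβL
  have hfloor : 2 * c₁ * (β ^ (38 * E))⁻¹ * Real.exp (2 * β) ^ E ≤
      Real.exp (-(8 * (P : ℝ) + 2 * E)) * (((5 : ℝ) ^ 8 * (8 * β + 1) ^ 19)⁻¹) ^ (2 * E) * Real.exp (2 * β) ^ E := by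
    refine mul_le_mul_of_nonneg_right ?_ (by positivity)
    have : 2 * c₁ * (β ^ (38 * E))⁻¹ = Real.exp (-(8 * (P : ℝ) + 2 * E)) * ((((5 : ℝ) ^ 8 * 9 ^ 19)⁻¹) ^ (2 * E) * (β ^ (38 * E))⁻¹) := by
      rw [hc₁]; ring
    rw [this]
    exact mul_le_mul_of_nonneg_left hVpow (Real.exp_pos _).le
  -- X ≤ e^{2βE} e^{-β/(2L²)} ≤ c₁ β^{-38E} e^{2βE}
  have hX := qform_sheetTrial_cross_le (L := L) hβ0.le
  have hsep : Real.exp (β * (2 * (E : ℝ) - (1 / (L : ℝ)) ^ 2 / 2)) ≤ c₁ * (β ^ (38 * E))⁻¹ * Real.exp (2 * β) ^ E := by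
    have h := hβ₂ β hββ₂   -- (1/c₁) β^{38E} ≤ exp((1/L)²/2 · β)
    have hsplit : Real.exp (β * (2 * (E : ℝ) - (1 / (L : ℝ)) ^ 2 / 2)) =
        Real.exp (2 * β) ^ E * (Real.exp ((1 / (L : ℝ)) ^ 2 / 2 * β))⁻¹ := by
      rw [← Real.exp_nat_mul, ← Real.exp_neg, ← Real.exp_add]; congr 1; ring
    rw [hsplit]
    have hβpow : 0 < β ^ (38 * E) := pow_pos hβ0 _
    have hexp : (Real.exp ((1 / (L : ℝ)) ^ 2 / 2 * β))⁻¹ ≤ c₁ * (β ^ (38 * E))⁻¹ := by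
      rw [← one_div, div_le_iff₀ (Real.exp_pos _), mul_assoc]
      have h' : 1 / c₁ * β ^ (38 * E) * (c₁ * (β ^ (38 * E))⁻¹) = 1 := by field_simp
      calc (1 : ℝ) = 1 / c₁ * β ^ (38 * E) * (c₁ * (β ^ (38 * E))⁻¹) := h'.symm
        _ ≤ Real.exp ((1 / (L : ℝ)) ^ 2 / 2 * β) * (c₁ * (β ^ (38 * E))⁻¹) := mul_le_mul_of_nonneg_right h (by positivity)
        _ = c₁ * ((β ^ (38 * E))⁻¹ * Real.exp ((1 / (L : ℝ)) ^ 2 / 2 * β)) := by ring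
    calc Real.exp (2 * β) ^ E * (Real.exp ((1 / (L : ℝ)) ^ 2 / 2 * β))⁻¹
        ≤ Real.exp (2 * β) ^ E * (c₁ * (β ^ (38 * E))⁻¹) := mul_le_mul_of_nonneg_left hexp (by positivity)
      _ = c₁ * (β ^ (38 * E))⁻¹ * Real.exp (2 * β) ^ E := by ring
  -- β^{-(38E+1)} latCE ≤ c₁ β^{-38E} e^{2βE}
  have hlat : β ^ (-(((38 * E + 1 : ℕ) : ℝ))) * latCE L β ≤ c₁ * (β ^ (38 * E))⁻¹ * Real.exp (2 * β) ^ E := by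
    rw [Real.rpow_neg hβ0.le, Real.rpow_natCast, pow_succ, mul_inv]
    have hCE := latCE_le (L := L) hβ0.le
    have hβinv : β⁻¹ ≤ c₁ := by
      rw [inv_le_comm₀ hβ0 hc₁pos, ← one_div]; exact hβc
    calc (β ^ (38 * E))⁻¹ * β⁻¹ * latCE L β ≤ (β ^ (38 * E))⁻¹ * c₁ * Real.exp (2 * β) ^ E :=
          mul_le_mul (mul_le_mul_of_nonneg_left hβinv (by positivity)) hCE (latCE_pos hβ0.le).le (by positivity)
      _ = c₁ * (β ^ (38 * E))⁻¹ * Real.exp (2 * β) ^ E := by ring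
  -- assemble
  have hE' : (E : ℝ) = (Fintype.card (Edge 3 L) : ℝ) := by rw [hE]
  calc β ^ (-(((38 * E + 1 : ℕ) : ℝ))) * latCE L β ≤ c₁ * (β ^ (38 * E))⁻¹ * Real.exp (2 * β) ^ E := hlat
    _ = 2 * c₁ * (β ^ (38 * E))⁻¹ * Real.exp (2 * β) ^ E - c₁ * (β ^ (38 * E))⁻¹ * Real.exp (2 * β) ^ E := by ring
    _ ≤ qform su2Rep β (sheetTrial (L := L)) sheetTrial -
          qform su2Rep β (sheetTrial (L := L)) (fun U => sheetTrial (configPerm (Equiv.swap (0 : Fin 3) 1) U)) :=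
        sub_le_sub (hfloor.trans hQ) (hX.trans hsep)

end FlatSheet

end Summit.QuantumFields.YangMills.Theorems.FemtoTransferGap

end
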